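import Literature.AnabelianGeometry.EtaleTheta.TemperedFrobenioidOfDiagonalBase
import Literature.AnabelianGeometry.EtaleTheta.Discharge.Sec3CuspidallyPureOfRankOneObject
import Literature.AlgebraicGeometry.Frobenioids.PerfectionPrimes
import Literature.AlgebraicGeometry.Frobenioids.MonoidTransport

/-!
# [EtTh] Def. 3.6 (v) «cuspidally pure» for the HIGHER-RANK engine `TemperedFrobenioid.ofDiagonalBase`, REDUCED to the combinatorics of `Φ₀` (p. 304 / PDF p. 78)

S. Mochizuki, *The étale theta function and its Frobenioid-theoretic manifestations*, Publ. RIMS **45** (2009)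
[cite: MochizukiEtTh2009, Def 3.6 (v) p.304 (PDF p.78); Def 3.3 (iii) p.299 (PDF p.73); Rmk 3.3.1 p.299 (PDF p.73)]:
Def. 3.6 (v) «`Φ` is cuspidally pure if (a) for every non-cuspidal primary element `x ∈ Φ(A)` there exists `y ∈ Φ^{bs-fld}(A)` with
`x ≤ y`; (b) `Prime(Φ(A)) = Prime(Φ(A))^ncsp ∪ Prime(Φ(A))^csp` (disjoint union)».

PROOF-ONLY companion (no `def`, no instance, no new named fact).  abc-iut cell, layer L2, seat abc-iut-w6-d047 (gen 4), self-named sequel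
«ZTOWER-CUSP-PURE» of the EX39-DATUM BRIDGE (p482977; census 02:0xZ): abc-iut-f-128's `isCuspidallyPure_ofRankOneObject` (p480739) settles
Def. 3.6 (v) at the RANK-ONE engine, where (a) degenerates to `Φ^{bs-fld} = Φ`.  THIS FILE treats abc-iut-w5-d179's HIGHER-RANK engine
`TemperedFrobenioid.ofDiagonalBase hpf P …` (`TemperedFrobenioidOfDiagonalBase`, p462637: `Φ(A) = im(Φ₀(F A)^pf → Φ₀(F A)^rlf)`,
**`Φ^{bs-fld}(A) = ι(⟨d_A⟩^pf)` a PROPER submonoid in rank `> 1`** — `ofDiagonalBase_bsFld_carrier`), where (a) has CONTENT, and REDUCES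
Def. 3.6 (v) for it to three statements about the Def. 3.3 (iii) monoids `Φ₀(F A)` ALONE:
* `hN : ncsp₀(F A) = Φ₀(F A)` and `hC : csp₀(F A) = 1` («every log-divisor is supported in the special fibre» — the case of every
  Def. 3.3 (iii) datum of record so far; f-128's weak support calculus `ofRlfZWeak_mem_ncspR_of_mem_pfImage_of_ncsp₀_eq_top` /
  `ofRlfZWeak_eq_one_of_mem_cspR_of_csp₀_eq_bot` then gives (b), ONE-SIDED: every prime non-cuspidal, none cuspidal);
* `hdiag : every PRIMARY element `m ∈ Φ₀(F A)` divides a power `d_A^c` of the diagonal` (Rmk. 3.3.1: the primes of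
  `Div⁺(Z^log_∞)^{Gal}` are the Galois ORBITS of prime log-divisors, each a summand of the reduced special fibre `d_A = div(ϖ)`) — then
  (a): a primary `x = ι(m^{1/n}) ∈ Φ(A)` (`Φ(A) ≅ Φ₀(F A)^pf`, abc-iut-L2-d2's `mrangeRestrict_toRealification_bijective`; primariness
  transported by `isPrimary_map_iff` and abc-iut-L1's `Perfection.isPrimary_mk_iff`) satisfies `x ∣ ι(m) ∣ ι(d_A^c) ∈ ι(⟨d_A⟩^pf) = Φ^{bs-fld}(A)`.
RESULT `TemperedFrobenioid.isCuspidallyPure_ofDiagonalBase_of_primary_dvd_diag hN hC hdiag`.  For the ℤ-tower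
(`ZTowerTempered.temperedFrobenioid`, rank `[ℤ : φ(H)] > 1`) `hN`/`hC` are immediate from `TateTower.model` (`nonCuspidal := ⊤`,
`cuspidal := ⊥`) and `hdiag` is the orbit combinatorics of abc-iut-w5-d179's `LogDivisorModelZTowerRays` (sequel).
HONEST LABEL: (b) here is one-sided by hypothesis (`csp₀ = 1`); a two-sided instance needs a Def. 3.3 (iii) datum WITH CUSPS (abc-iut-L2-t3's Tate
tower v3); class (b) engine over interface records; nothing here bears on [IUTchIII] Cor. 3.12; typed ≠ proved; no side taken.
[claim: MochizukiEtTh2009, status: refereed pre-IUT]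
-/

noncomputable section

namespace Literature.AnabelianGeometry.EtaleTheta

open CategoryTheory Opposite Function Literature.AlgebraicGeometry.Frobenioids

universe u₀ v₀ u v

namespace TemperedFrobenioid

section DiagonalBaseCuspidallyPure

variable {D₀ : Type u₀} [Category.{v₀} D₀] {dm : DivisorMonoids.{u₀, v₀, 0} D₀}
  (hpf : ∀ Y : D₀ᵒᵖ, IsPerfFactorialCof (dm.Φ₀.obj Y)) {D : Type u} [Category.{v} D] (P : DiagonalBase dm D)
  (hD : IsConnected D) (hD' : IsTotallyEpimorphic D) (hFSM : IsOfFSMType D) (R S : (Dᵒᵖ ⥤ CommMonCat.{0}) → Prop)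

/-- **Every element of `Φ(A) = im(Φ₀(F A)^pf → Φ₀^rlf)` is NON-CUSPIDAL when `ncsp₀(F A) = Φ₀(F A)`** (f-128's weak support calculus at a
FULL non-cuspidal part). [cite: MochizukiEtTh2009, Def 3.6 (iii) p.303 (PDF p.77)] -/
theorem isNonCuspidal_ofDiagonalBase_of_ncsp₀_eq_top (hN : ∀ A : D, dm.ncsp₀ (op (P.F.obj A)) = ⊤) (A : Dᵒᵖ)
    (x : (ofDiagonalBase hpf P hD hD' hFSM R S).Φ.carrier A) : (ofDiagonalBase hpf P hD hD' hFSM R S).IsNonCuspidal x :=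
  RealifiedDivisorMonoids.ofRlfZWeak_mem_ncspR_of_mem_pfImage_of_ncsp₀_eq_top dm hpf (op (P.F.obj A.unop)) (hN A.unop) x.2

/-- **Def. 3.6 (v)(b), first half, for the diagonal-base engine with `ncsp₀ = Φ₀`: every prime of `Φ(A)` is non-cuspidal (or cuspidal).**
[cite: MochizukiEtTh2009, Def 3.6 (v) p.304 (PDF p.78)] -/
theorem ncsp_or_csp_ofDiagonalBase_of_ncsp₀_eq_top (hN : ∀ A : D, dm.ncsp₀ (op (P.F.obj A)) = ⊤) (A : Dᵒᵖ)
    (𝔭 : Primes ((ofDiagonalBase hpf P hD hD' hFSM R S).Φ.carrier A)) :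
    𝔭 ∈ (ofDiagonalBase hpf P hD hD' hFSM R S).ncspPrimes A ∨ 𝔭 ∈ (ofDiagonalBase hpf P hD hD' hFSM R S).cspPrimes A :=
  Or.inl fun x _ => isNonCuspidal_ofDiagonalBase_of_ncsp₀_eq_top hpf P hD hD' hFSM R S hN A x

/-- **Def. 3.6 (v)(b), second half, for the diagonal-base engine with `csp₀ = 1`: no prime of `Φ(A)` is both non-cuspidal and cuspidal** — a
cuspidal element is `1` (f-128's `ofRlfZWeak_eq_one_of_mem_cspR_of_csp₀_eq_bot`), a primary one is not.
[cite: MochizukiEtTh2009, Def 3.6 (v) p.304 (PDF p.78)] -/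
theorem not_ncsp_and_csp_ofDiagonalBase_of_csp₀_eq_bot (hC : ∀ A : D, dm.csp₀ (op (P.F.obj A)) = ⊥) (A : Dᵒᵖ)
    (𝔭 : Primes ((ofDiagonalBase hpf P hD hD' hFSM R S).Φ.carrier A)) :
    ¬ (𝔭 ∈ (ofDiagonalBase hpf P hD hD' hFSM R S).ncspPrimes A ∧ 𝔭 ∈ (ofDiagonalBase hpf P hD hD' hFSM R S).cspPrimes A) := by
  rintro ⟨-, hcsp⟩
  obtain ⟨⟨a, ha⟩, rfl⟩ := Quotient.mk_surjective 𝔭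
  have hmem : a ∈ Primes.carrier (Quotient.mk (primarySetoid _) ⟨a, ha⟩) := ⟨ha, rfl⟩
  exact ha.1 (Subtype.ext
    (RealifiedDivisorMonoids.ofRlfZWeak_eq_one_of_mem_cspR_of_csp₀_eq_bot dm hpf (op (P.F.obj A.unop)) (hC A.unop) (hcsp a hmem)))

/-- **A PRIMARY element of `Φ(A) = im(Φ₀(F A)^pf → Φ₀^rlf)` is `ι(m^{1/n})` with `m` PRIMARY in `Φ₀(F A)`** (`Φ(A) ≅ Φ₀(F A)^pf` by the
injectivity of the weak realification map; `a^{1/n}` is primary iff `a` is, `Φ₀` sharp). [cite: MochizukiFrdI2008, §0 p.12] -/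
theorem exists_eq_toRealification_mk_of_isPrimary (A : Dᵒᵖ) (x : (ofDiagonalBase hpf P hD hD' hFSM R S).Φ.carrier A)
    (hx : IsPrimary x) :
    ∃ (m : dm.Φ₀.obj (op (P.F.obj A.unop))) (n : ℕ+), IsPrimary m ∧
      x = ⟨(hpf (op (P.F.obj A.unop))).weak.toRealification (Perfection.mk m n), ⟨Perfection.mk m n, rfl⟩⟩ := by
  set e := MulEquiv.ofBijective _ (PfImageWeak.mrangeRestrict_toRealification_bijective (hpf (op (P.F.obj A.unop))).weak) with he
  obtain ⟨⟨m, n⟩, hmn⟩ := Perfection.mk_surjective (e.symm x)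
  refine ⟨m, n, ?_, ?_⟩
  · have h1 : IsPrimary (e.symm x) := (isPrimary_map_iff e.symm).mpr hx
    rw [← hmn] at h1
    exact (Perfection.isPrimary_mk_iff (hpf (op (P.F.obj A.unop))).weak.isDivisorial.isSharp).mp h1
  · have h2 : x = e (Perfection.mk m n) := by
      rw [show Perfection.mk m n = e.symm x from hmn, MulEquiv.apply_symm_apply]
    rw [h2]
    rfl

/-- **Def. 3.6 (v)(a) for the diagonal-base engine, from the orbit combinatorics of `Φ₀`**: if every primary `m ∈ Φ₀(F A)` divides a power
`d_A^c` of the diagonal (Rmk. 3.3.1: a prime of `Div⁺(Z^log_∞)^{Gal}` is a Galois orbit of components, a summand of the reduced special fibre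
`d_A = div(ϖ)`), then every primary `x ∈ Φ(A)` divides the base-field-theoretic element `ι(d_A^c) ∈ ι(⟨d_A⟩^pf) = Φ^{bs-fld}(A)`
(`x = ι(m^{1/n})`, `ι(d_A^c) = x · (x^{n-1} · ι(d_A^c / m))`). [cite: MochizukiEtTh2009, Def 3.6 (v) p.304 (PDF p.78); Rmk 3.3.1 p.299 (PDF p.73)] -/
theorem exists_bsFld_dvd_ofDiagonalBase_of_primary_dvd_diag
    (hdiag : ∀ (A : D) (m : dm.Φ₀.obj (op (P.F.obj A))), IsPrimary m → ∃ c : ℕ, m ∣ P.d A ^ c) (A : Dᵒᵖ)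
    (x : (ofDiagonalBase hpf P hD hD' hFSM R S).Φ.carrier A) (hx : IsPrimary x) :
    ∃ y : (ofDiagonalBase hpf P hD hD' hFSM R S).Φ.carrier A, (ofDiagonalBase hpf P hD hD' hFSM R S).IsBaseFieldTheoreticDiv y ∧ x ∣ y := by
  obtain ⟨m, n, hm, rfl⟩ := exists_eq_toRealification_mk_of_isPrimary hpf P hD hD' hFSM R S A x hx
  obtain ⟨c, k, hk⟩ := hdiag A.unop m hm
  -- in `Φ₀(F A)^pf`: `d^c = m k = (m^{1/n})^n k = m^{1/n} · ((m^{1/n})^{n-1} · k)`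
  have hpfeq : Perfection.of (dm.Φ₀.obj (op (P.F.obj A.unop))) (P.d A.unop ^ c) =
      Perfection.mk m n * (Perfection.mk m n ^ ((n : ℕ) - 1) * Perfection.of (dm.Φ₀.obj (op (P.F.obj A.unop))) k) := by
    rw [hk, map_mul, ← mul_assoc, mul_pow_sub_one n.ne_zero, Perfection.mk_pow_self]
  refine ⟨⟨(hpf (op (P.F.obj A.unop))).weak.toRealification
      (Perfection.of (dm.Φ₀.obj (op (P.F.obj A.unop))) (P.d A.unop ^ c)), ⟨_, rfl⟩⟩, ?_,
    ⟨⟨(hpf (op (P.F.obj A.unop))).weak.toRealification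
      (Perfection.mk m n ^ ((n : ℕ) - 1) * Perfection.of (dm.Φ₀.obj (op (P.F.obj A.unop))) k), ⟨_, rfl⟩⟩,
      Subtype.ext ((congrArg (hpf (op (P.F.obj A.unop))).weak.toRealification hpfeq).trans (map_mul _ _ _))⟩⟩
  -- `ι(d^c) = ι((d^{•})^pf (c^{1/1})) ∈ ι(⟨d⟩^pf) = Φ^{bs-fld}(A)`
  change (hpf (op (P.F.obj A.unop))).weak.toRealification
      (Perfection.of (dm.Φ₀.obj (op (P.F.obj A.unop))) (P.d A.unop ^ c)) ∈
    (ofDiagonalBase hpf P hD hD' hFSM R S).bsFld.carrier A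
  rw [ofDiagonalBase_bsFld_carrier]
  exact ⟨Perfection.of (Multiplicative ℕ) (Multiplicative.ofAdd c), rfl⟩

/-- **Def. 3.6 (v) «cuspidally pure» for the higher-rank engine `ofDiagonalBase`, REDUCED to `Φ₀`**: `ncsp₀(F A) = Φ₀(F A)`, `csp₀(F A) = 1`,
and every primary log-divisor divides a power of the diagonal ⇒ `Φ` is cuspidally pure ((a) with content: `Φ^{bs-fld} = ι(⟨d_A⟩^pf)` is a
PROPER submonoid in rank `> 1`; (b) one-sided). [cite: MochizukiEtTh2009, Def 3.6 (v) p.304 (PDF p.78)] -/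
theorem isCuspidallyPure_ofDiagonalBase_of_primary_dvd_diag (hN : ∀ A : D, dm.ncsp₀ (op (P.F.obj A)) = ⊤)
    (hC : ∀ A : D, dm.csp₀ (op (P.F.obj A)) = ⊥)
    (hdiag : ∀ (A : D) (m : dm.Φ₀.obj (op (P.F.obj A))), IsPrimary m → ∃ c : ℕ, m ∣ P.d A ^ c) :
    (ofDiagonalBase hpf P hD hD' hFSM R S).IsCuspidallyPure where
  exists_bsFld_dvd A x hx _ := exists_bsFld_dvd_ofDiagonalBase_of_primary_dvd_diag hpf P hD hD' hFSM R S hdiag A x hx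
  ncsp_or_csp := ncsp_or_csp_ofDiagonalBase_of_ncsp₀_eq_top hpf P hD hD' hFSM R S hN
  not_ncsp_and_csp := not_ncsp_and_csp_ofDiagonalBase_of_csp₀_eq_bot hpf P hD hD' hFSM R S hC

end DiagonalBaseCuspidallyPure

end TemperedFrobenioid

end Literature.AnabelianGeometry.EtaleTheta

end
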